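import Summits.HodgeConjecture.HodgeConjecture.Theorems.MarkmanPartnerTransportPicardThreeK3SquaresZeta9Subtype
import HarnessLib

/-!
# Route MarkmanPartnerTransport · crux `PicardThreeK3Squares` (stmt-HodgeConjecture-19652) —
# HC⁴(S ⊗ S) BY NAME for the sub-types of the ζ₉ real-multiplication type (Picard number 13 included)

Cell hodge-nonav, crux #4 (HC⁴(S ⊗ S), ρ(S) ≥ 3; open core: real multiplication), programme «RATIONAL ORBIT
DENSITY» continued (prover seat hodge-nonav-19652-p1 gen 20; `--supports stmt-HodgeConjecture-19652`,
helper). Sequel to `…Zeta9Subtype` (`hodgeConjectureFor_square_of_zeta9Model_of_openAll`: (T⁗) for a ζ₉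
datum GIVEN the strong open input). Here the input is supplied BY NAME by the ∀-member form of the van
Geemen–Schütt ζ₉ fact, `VanGeemenSchuett2025_zeta9_cycleOnOpenPeriodSet_everyMember`
(`Literature/…/K3RealMultiplicationZeta9OpenFamily`: the cycle `Γ₁ + Γ₋₁` on EVERY member of the maximal
Dickson family over an open period set, with a `θ`-generic witness). CONDITIONAL on the two named facts
`Buskin2019_hodgeIsometry_algebraic` and `VanGeemenSchuett2025_zeta9_cycleOnOpenPeriodSet_everyMember`
ONLY; credits nothing; nothing here says HC is proved; rung F-H1 not moved.

* `zeta9_cycleOnOpenPeriodSet_of_everyMember` — the ∀-member fact implies the `θ`-generic fact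
  `VanGeemenSchuett2025_zeta9_cycleOnOpenPeriodSet` (consistency of the two records).
* **`exists_zeta9Subtype_hodgeConjectureFor_square`** — THERE IS a ζ₉ datum `(g, y₀, θ)` such that
  EVERY marked projective K3 surface with an endomorphism `t` (rational, type-preserving, killing `N¹`,
  `t³ - 3t + 1 = 0` on `T(S)`, generating `End_Hdg T(S)`) conjugate to `θ_ℂ` ON `T(S)` by a rational
  isometry of `Λ_ℚ` has `HodgeConjectureFor 4 (S ⊗ S)` — HC⁴ of the square of every K3 surface with
  real multiplication by `F = ℚ(ζ₉ + ζ₉⁻¹)` whose `F`-quadratic space `(T(S)_ℚ, Φ_S)` is represented by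
  the ζ₉ model's (Witt over `ℚ`; not formalised): Picard number `10` (the type: gen 12's
  `exists_zeta9Type_hodgeConjectureFor_square`) or `13` (NEW; a condition on the ternary `F`-form —
  the first kernel content on the cell's plan-only rung «RungRank13»).

No definition, no sorry. References: van Geemen–Schütt, Forum Math. Sigma 13 (2025) e2, Thm. 1.1 (9),
§3.4, §4.8, §5.6, §6.6; Artebani–Comparin–Valdés, Comm. Algebra 48 (2020), Ex. 3.5; Buskin, J. reine
angew. Math. 755 (2019), Thm. 1.1; van Geemen, Michigan Math. J. 56 (2008) Lemma 3.2; O'Meara,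
*Introduction to Quadratic Forms*, 63:21, 66:3.
-/

set_option linter.dupNamespace false

noncomputable section

namespace Summit.HodgeConjecture.HodgeConjecture.Theorems.MarkmanPartnerTransport.RMTypeOrbit

open CategoryTheory MonoidalCategory Polynomial
open Literature.AlgebraicGeometry Literature.AlgebraicGeometry.Motives Literature.AlgebraicGeometry.HodgeTheory
open Literature.AlgebraicGeometry.Surfaces Literature.LinearAlgebra.QuadraticForm
open Literature.AlgebraicTopology.SingularHomology
open Summit.HodgeConjecture.HodgeConjecture.Theorems.NikulinTwinTransport
open Summit.HodgeConjecture.HodgeConjecture.Theorems.MarkmanPartnerTransport.IsogenyInvariance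
open Summit.HodgeConjecture.HodgeConjecture.Theorems.MarkmanPartnerTransport.RMTypeDescent

/-- `MarkedK3[S, η, p, x]`: VERBATIM the `let MarkedK3 := …` binder of the route declaration
`PicardThreeK3Squares` (as in `…RMTypeDescent`). Local notation only. -/
local notation3 (prettyPrint := false) "MarkedK3[" S ", " η ", " p ", " x "]" =>
  (p ≠ 0 ∧ (IsIntegralClass p ∧
    (∀ q : complexBetti S (2 * 2), IsIntegralClass q → ∃ n : ℤ, q = n • p) ∧
    (∀ c : complexBetti S (2 * 1), IsIntegralClass c ↔ ∃ v : K3Index → ℤ, η c = fun i => (v i : ℂ)) ∧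
    (∀ a b : complexBetti S (2 * 1),
      cupProduct (rfl : 2 * 1 + 2 * 1 = 2 * 2) a b = k3Form (η a) (η b) • p) ∧
    IsOfHodgeType 2 S (2 * 1) 2 0 (LinearEquiv.symm η x) ∧
    (∀ τ : complexBetti S (2 * 1), IsOfHodgeType 2 S (2 * 1) 2 0 τ →
      ∃ t : ℂ, τ = t • LinearEquiv.symm η x)) ∧
    (k3Form x x = 0 ∧ 0 < (k3Form (star x) x).re ∧
      ∃ u : K3Index → ℤ, k3Form (fun i => (u i : ℂ)) x = 0 ∧ 0 < ∑ i, ∑ j, u i * k3Gram i j * u j))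

/-- `Zeta9Model[g, y₀, θ]`: VERBATIM the datum conjuncts of the named fact
`VanGeemenSchuett2025_zeta9_cycleOnOpenPeriodSet` (as in `…Zeta9Type`). Local notation only. -/
local notation3 (prettyPrint := false) "Zeta9Model[" g ", " y₀ ", " θ "]" =>
  ((∀ a b : K3Index → ℂ, k3Form (g a) (g b) = k3Form a b) ∧
    (∀ v : K3Index → ℤ, ∃ w : K3Index → ℤ,
      g (fun i => ((v i : ℤ) : ℂ)) = fun i => ((w i : ℤ) : ℂ)) ∧
    g ^ 9 = 1 ∧
    Module.finrank ℂ (LinearMap.ker (g ^ 3 - 1)) = 10 ∧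
    k3Form y₀ y₀ = 0 ∧ 0 < (k3Form (star y₀) y₀).re ∧
    g y₀ = Complex.exp (2 * Real.pi * Complex.I / 9) • y₀ ∧
    (∀ y : K3Index → ℂ, thetaC θ y =
      (1 / 3 : ℂ) • ((2 : ℂ) • g y + (2 : ℂ) • (g ^ 8) y - (g ^ 2) y - (g ^ 4) y - (g ^ 5) y
        - (g ^ 7) y)))

/-- The cubic `X³ - 3X + 1 ∈ ℚ[X]` (minimal polynomial of `2cos(2π/9)`). Local notation only. -/
local notation3 (prettyPrint := false) "P₉" => (X ^ 3 - C (3 : ℚ) * X + 1 : ℚ[X])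

/-- `SubSquareHC[θ]`: **HC⁴(S ⊗ S) for every marked projective K3 surface whose endomorphism `t`
(rational, type-preserving, killing `N¹`, annihilated on `T(S)` by `X³ - 3X + 1`, generating
`End_Hdg T(S)`) is conjugate to `θ_ℂ` ON THE TRANSCENDENTAL CLASSES by a rational isometry `σ` of
`Λ_ℚ`** — the sub-types of `θ` (Noether–Lefschetz-special surfaces included). Local notation only. -/
local notation3 (prettyPrint := false) "SubSquareHC[" θ "]" =>
  (∀ (S : SchemeOver ℂ) (hS : IsK3Surface S)
    (η : complexBetti S (2 * 1) ≃ₗ[ℂ] (K3Index → ℂ)) (p : complexBetti S (2 * 2)) (x : K3Index → ℂ)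
    (_hM : MarkedK3[S, η, p, x])
    (t : complexBetti S (2 * 1) →ₗ[ℂ] complexBetti S (2 * 1))
    (_ht_rat : ∀ y, IsRationalClass y → IsRationalClass (t y))
    (_ht_typ : ∀ (i j : ℕ) (y : complexBetti S (2 * 1)),
      IsOfHodgeType 2 S (2 * 1) i j y → IsOfHodgeType 2 S (2 * 1) i j (t y))
    (_ht_N : ∀ d ∈ algebraicClasses S 1, t d = 0)
    (_hP : IsAnnihilatedOnTranscendentalBy S t P₉) (_hgen : TranscendentalEndomorphismsGeneratedBy S t)
    (σ : Module.End ℂ (K3Index → ℂ)) (_hσ : ∀ a b, k3Form (σ a) (σ b) = k3Form a b)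
    (_hσrat : ∀ v : K3Index → ℤ, ∃ w : K3Index → ℚ, σ (fun i => (v i : ℂ)) = fun i => (w i : ℂ))
    (_hconj : ∀ c : complexBetti S (2 * 1),
      (∀ d ∈ algebraicClasses S 1, cupProduct (rfl : 2 * 1 + 2 * 1 = 2 * 2) c d = 0) →
        σ (η (t c)) = thetaC θ (σ (η c))),
    HodgeConjectureFor 4 (S ⊗ S))

/-- **The ∀-member fact implies the `θ`-generic one** (`VanGeemenSchuett2025_zeta9_cycleOnOpenPeriodSet`):
drop the genericity clause of the witness and restrict the cycle clause. [cite: GeemenSchutt2023, Thm. 1.1 (9) and §4.8] -/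
theorem zeta9_cycleOnOpenPeriodSet_of_everyMember (h : VanGeemenSchuett2025_zeta9_cycleOnOpenPeriodSet_everyMember) :
    VanGeemenSchuett2025_zeta9_cycleOnOpenPeriodSet := by
  obtain ⟨g, y₀, θ, hg, hgint, hg9, hfin, hy₀₀, hy₀p, hgy₀, hθ, U, hU, ⟨y₁, hy₁U, hy₁, h₁₁, h₁p, -⟩, hcyc⟩ :=
    h
  exact ⟨g, y₀, θ, hg, hgint, hg9, hfin, hy₀₀, hy₀p, hgy₀, hθ, U, hU, ⟨y₁, hy₁U, hy₁, h₁₁, h₁p⟩,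
    fun y hyU hy hyy hyp _ => hcyc y hyU hy hyy hyp⟩

/-- **HC⁴(S ⊗ S) for every K3 surface of a SUB-TYPE of the ζ₉ real-multiplication type** — the
Noether–Lefschetz-special surfaces of the ζ₉ locus included. THERE IS a ζ₉ datum `(g, y₀, θ)` (as in
`exists_zeta9Type_hodgeConjectureFor_square`) such that EVERY projective K3 surface `S`, marked by
`(η, p, x)` and carrying an endomorphism `t` of `H²(S(ℂ); ℂ)` — rational, Hodge-type preserving, killing
`N¹H²`, with `t³ - 3t + 1 = 0` on `T(S)` (real multiplication by the cubic field
`ℚ[t] ≅ ℚ(ζ₉ + ζ₉⁻¹)`), generating `End_Hdg T(S)` — which is conjugate to `θ_ℂ` ON `T(S)` by a rational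
isometry `σ` of `Λ_ℚ` (`σ η (t c) = θ_ℂ σ η c` for `c ⊥ N¹(S)`; NOT necessarily on `N¹(S)`), satisfies
`HodgeConjectureFor 4 (S ⊗ S)`. Which surfaces these are (NOT formalised): by Witt's theorem over `ℚ`,
exactly the `S` whose pair `(T(S)_ℚ, t)` embeds isometrically and `t ↦ θ`-equivariantly into the model
`(Λ_ℚ, θ)`, i.e. whose `F`-quadratic space `(T(S)_ℚ, Φ_S)` (`F = ℚ[t]`, `q = tr_{F/ℚ} Φ_S`) is
REPRESENTED by the model's `F`-quadratic space of `F`-rank `4`; so `rank_F T(S) ∈ {3, 4}`, i.e.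
`ρ(S) ∈ {13, 10}` (van Geemen: `rank_F T ≥ 3`), and at `ρ(S) = 13` — the cell's plan-only rung
«RungRank13» (cubic RM, compact Shimura-curve base) — the representation of the ternary `Φ_S` by the
quaternary model form is a CONDITION (Hasse–Minkowski over `F`: local symbols at the finitely many ramified
and bad primes; the real places are matched by choosing `t` among the three roots), met by some and not by
all such `S`. The `θ`-generic surfaces (`ρ(S) = 10`) are the case of
`exists_zeta9Type_hodgeConjectureFor_square`; the new surfaces are the `ρ(S) = 13` ones. Proof: the fact
supplies the datum and `OpenAll[θ, e₀]`; `hodgeConjectureFor_square_of_zeta9Model_of_openAll`.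
CONDITIONAL on `Buskin2019_hodgeIsometry_algebraic` and
`VanGeemenSchuett2025_zeta9_cycleOnOpenPeriodSet_everyMember` ONLY; credits nothing; HC is NOT proved here;
rung F-H1 not moved. [cite: GeemenSchutt2023, Thm. 1.1 (9), §3.4, §4.8, §5.6 and §6.6]
[cite: ArtebaniComparinValdes2020Order9, Example 3.5] [cite: Buskin2019, Thm. 1.1]
[cite: Omeara1963, 63:21 and 66:3] [cite: VanGeemen2008RM, Lemma 3.2] -/
theorem exists_zeta9Subtype_hodgeConjectureFor_square
    (hB : Buskin2019_hodgeIsometry_algebraic) (hV : VanGeemenSchuett2025_zeta9_cycleOnOpenPeriodSet_everyMember) :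
    ∃ (g : Module.End ℂ (K3Index → ℂ)) (y₀ : K3Index → ℂ) (θ : Matrix K3Index K3Index ℚ),
      Zeta9Model[g, y₀, θ] ∧ SubSquareHC[θ] := by
  obtain ⟨g, y₀, θ, hg, hgint, hg9, hfin, hy₀₀, hy₀p, hgy₀, hθ, U, hU, ⟨y₁, hy₁U, hy₁, h₁₁, h₁p, hy₁gen⟩,
    hcyc⟩ := hV
  refine ⟨g, y₀, θ, ⟨hg, hgint, hg9, hfin, hy₀₀, hy₀p, hgy₀, hθ⟩, ?_⟩
  exact hodgeConjectureFor_square_of_zeta9Model_of_openAll hB ⟨hg, hgint, hg9, hfin, hy₀₀, hy₀p, hgy₀, hθ⟩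
    ⟨U, hU, ⟨y₁, hy₁U, hy₁, h₁₁, h₁p, hy₁gen⟩, fun y hyU hy hyy hyp =>
      let ⟨S', hS', η', p', hM', hγ'⟩ := hcyc y hyU hy hyy hyp
      ⟨S', hS', η', p', hM', hγ'⟩⟩

end Summit.HodgeConjecture.HodgeConjecture.Theorems.MarkmanPartnerTransport.RMTypeOrbit

end
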